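import Summits.ResolutionOfSingularities.ResolutionOfSingularities.Theorems.FrobeniusLadderFInjectiveMacaulayficationX2CubicFormTStepRow
import HarnessLib

/-!
# THE POINT-BLOW-UP CHARTS OF A DOUBLE POINT `x² + F_d(Y₀..Y₃)` FOR A FORM OF ANY DEGREE `d ≥ 2` — res-L1-w45a-lead-1's ✓ `X2CubicFormFrontEnd` (degree 3) made degree-generic:
# `θ₄ f = X₄²·(1 + X₄^{d−2}·F)`, `θ_a f = X_a²·(X₄² + X_a^{d−2}·F|_{Y_a = 1})`, `f, G_i ∉ (X_i)`, vertex closed and singular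
# (crux `FInjectiveMacaulayfication` stmt-ResolutionOfSingularities-15315, chain w45a; this seat's TAKING line 01:30Z (β″) — FILE P, the chart package shared by the p = 3 quartic F-side
# class row (this seat) and habitat #3a `x² + F₄` (lead-1's T-side); seat res-L1-w45a-stub-1 g14)

[OURS · L1 W4.5a] Support file (`--supports stmt-ResolutionOfSingularities-15315 --as helper`); def-free; UNCONDITIONAL; no named fact; NOT a statement of any manuscript. Plumbing
only; nothing of the crux is proved. AI-written (AI review is weaker than expert review).

Letters (lead-1's): `F ∈ k[Y₀..Y₃]` homogeneous of degree `d`, `f = X₄² + F(X₀..X₃)`; dehomogenisations `aeval (σ a) F ∈ k[Z₀,Z₁,Z₂]` with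
`σ = ![![1,X0,X1,X2], ![X0,1,X1,X2], ![X0,X1,1,X2], ![X0,X1,X2,1]]`; embeddings `e = ![![1,2,3], ![0,2,3], ![0,1,3], ![0,1,2]] : Fin 4 → Fin 3 → Fin 5`.
* §1 `theta_four_deg` (`d ≥ 2`), `theta_castSucc_deg` (`d ≥ 2`) — the proofs of ✓ `theta_four` / `theta_castSucc` with the exponent made symbolic (`aeval_mul_of_isHomogeneous`).
* §2 `f_not_mem_span_X_deg` (`d ≠ 0`, `F ≠ 0`), `constantCoeff_f_deg`, `one_add_X_pow_mul_not_mem_span_X` (`1 + X₄^m·q ∉ (X₄)`), `X_sq_add_X_pow_mul_not_mem_span_X`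
  (`X₄² + X_a^m·W ∉ (X_a)`, `a ≠ 4`), `eval_zero_pderiv_f_deg` (`d ≥ 2`), `vertex_closed_singular_deg` (`v` closed, `v ∉ Reg`, and `dim 𝒪_{Y,v} = 4`).
[folklore; cite: Kollar2007, §2.5; Hartshorne1977, I Thm. 5.1; Matsumura1987, Thm. 13.5]
-/

-- single-problem summit: the doubled namespace component is forced
set_option linter.dupNamespace false

noncomputable section

namespace Summit.ResolutionOfSingularities.ResolutionOfSingularities.Theorems.FInjectiveMacaulayfication.X2FormPointFloor

open CategoryTheory CategoryTheory.Limits AlgebraicGeometry TopologicalSpace IsLocalRing MvPolynomial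
open Literature.AlgebraicGeometry.Resolution
open Summit.ResolutionOfSingularities.ResolutionOfSingularities.Theorems.FInjectiveMacaulayfication
open SliceableCentre GermOfGlobalBlowup X2CubicFormFrontEnd

variable (k : Type) [Field k]

/-! ## §1 The chart identities for a form of degree `d ≥ 2` -/

/-- **The `x`-chart**: `θ₄ f = X₄²·(1 + X₄^{d−2}·F)` (`F` homogeneous of degree `d ≥ 2`: `F(X₀X₄, …, X₃X₄) = X₄^d·F`). [folklore; cite: Kollar2007, §2.5] -/
theorem theta_four_deg (d : ℕ) (hd : 2 ≤ d) (F : MvPolynomial (Fin 4) k) (hF : F.IsHomogeneous d) (f : MvPolynomial (Fin 5) k)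
    (hf : f = X 4 ^ 2 + rename (Fin.castSucc : Fin 4 → Fin 5) F) :
    MvPolynomial.aeval (fun j : Fin 5 => if j = (4 : Fin 5) then (X 4 : MvPolynomial (Fin 5) k) else X j * X 4) f =
      X 4 ^ 2 * (1 + X 4 ^ (d - 2) * rename (Fin.castSucc : Fin 4 → Fin 5) F) := by
  have hcomp : MvPolynomial.aeval (fun j : Fin 5 => if j = (4 : Fin 5) then (X 4 : MvPolynomial (Fin 5) k) else X j * X 4) (rename (Fin.castSucc : Fin 4 → Fin 5) F) =
      MvPolynomial.aeval (fun j : Fin 4 => (X 4 : MvPolynomial (Fin 5) k) * X (Fin.castSucc j)) F := by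
    rw [aeval_rename, show ((fun j : Fin 5 => if j = (4 : Fin 5) then (X 4 : MvPolynomial (Fin 5) k) else X j * X 4) ∘ Fin.castSucc) =
      (fun j : Fin 4 => (X 4 : MvPolynomial (Fin 5) k) * X (Fin.castSucc j)) from funext fun j => by
        have hj4 : Fin.castSucc j ≠ (4 : Fin 5) := (Fin.castSucc_lt_last j).ne
        simp only [Function.comp_apply]; rw [if_neg hj4, mul_comm]]
  have hscale := aeval_mul_of_isHomogeneous hF (X 4 : MvPolynomial (Fin 5) k) (fun j : Fin 4 => (X (Fin.castSucc j) : MvPolynomial (Fin 5) k))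
  have hid : MvPolynomial.aeval (fun j : Fin 4 => (X (Fin.castSucc j) : MvPolynomial (Fin 5) k)) F = rename (Fin.castSucc : Fin 4 → Fin 5) F := by
    show MvPolynomial.aeval (X ∘ Fin.castSucc) F = _
    rw [← aeval_rename, aeval_X_left_apply]
  rw [hf, map_add, map_pow, aeval_X, if_pos rfl, hcomp, hscale, hid]
  obtain ⟨e, rfl⟩ : ∃ e, d = e + 2 := ⟨d - 2, by omega⟩
  rw [Nat.add_sub_cancel]
  ring

/-- **The four singular charts**: `θ_a f = X_a²·(X₄² + X_a^{d−2} · rename (e a) (F|_{Y_a=1}))` for `a ≤ 3` (`F` homogeneous of degree `d ≥ 2`). [folklore; cite: Kollar2007, §2.5] -/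
theorem theta_castSucc_deg (d : ℕ) (hd : 2 ≤ d) (F : MvPolynomial (Fin 4) k) (hF : F.IsHomogeneous d) (f : MvPolynomial (Fin 5) k)
    (hf : f = X 4 ^ 2 + rename (Fin.castSucc : Fin 4 → Fin 5) F) (a : Fin 4) :
    MvPolynomial.aeval (fun j : Fin 5 => if j = Fin.castSucc a then (X (Fin.castSucc a) : MvPolynomial (Fin 5) k) else X j * X (Fin.castSucc a)) f =
      X (Fin.castSucc a) ^ 2 * (X 4 ^ 2 + X (Fin.castSucc a) ^ (d - 2) *
        rename ((![![1, 2, 3], ![0, 2, 3], ![0, 1, 3], ![0, 1, 2]] : Fin 4 → Fin 3 → Fin 5) a)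
          (MvPolynomial.aeval ((![![1, X 0, X 1, X 2], ![X 0, 1, X 1, X 2], ![X 0, X 1, 1, X 2], ![X 0, X 1, X 2, 1]] :
            Fin 4 → Fin 4 → MvPolynomial (Fin 3) k) a) F)) := by
  have hcomp : MvPolynomial.aeval (fun j : Fin 5 => if j = Fin.castSucc a then (X (Fin.castSucc a) : MvPolynomial (Fin 5) k) else X j * X (Fin.castSucc a))
      (rename (Fin.castSucc : Fin 4 → Fin 5) F) =
      MvPolynomial.aeval (fun j : Fin 4 => (X (Fin.castSucc a) : MvPolynomial (Fin 5) k) * (if j = a then 1 else X (Fin.castSucc j))) F := by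
    rw [aeval_rename, show ((fun j : Fin 5 => if j = Fin.castSucc a then (X (Fin.castSucc a) : MvPolynomial (Fin 5) k) else X j * X (Fin.castSucc a)) ∘ Fin.castSucc) =
      (fun j : Fin 4 => (X (Fin.castSucc a) : MvPolynomial (Fin 5) k) * (if j = a then 1 else X (Fin.castSucc j))) from funext fun j => by
        simp only [Function.comp_apply]
        by_cases hj : j = a
        · subst hj; rw [if_pos rfl, if_pos rfl, mul_one]
        · rw [if_neg (fun h => hj (Fin.castSucc_injective _ h)), if_neg hj, mul_comm]]
  have hscale := aeval_mul_of_isHomogeneous hF (X (Fin.castSucc a) : MvPolynomial (Fin 5) k) (fun j : Fin 4 => if j = a then (1 : MvPolynomial (Fin 5) k) else X (Fin.castSucc j))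
  have hsub : MvPolynomial.aeval (fun j : Fin 4 => if j = a then (1 : MvPolynomial (Fin 5) k) else X (Fin.castSucc j)) F =
      rename ((![![1, 2, 3], ![0, 2, 3], ![0, 1, 3], ![0, 1, 2]] : Fin 4 → Fin 3 → Fin 5) a)
        (MvPolynomial.aeval ((![![1, X 0, X 1, X 2], ![X 0, 1, X 1, X 2], ![X 0, X 1, 1, X 2], ![X 0, X 1, X 2, 1]] :
          Fin 4 → Fin 4 → MvPolynomial (Fin 3) k) a) F) := by
    have hhom : (MvPolynomial.aeval (fun j : Fin 4 => if j = a then (1 : MvPolynomial (Fin 5) k) else X (Fin.castSucc j)) : MvPolynomial (Fin 4) k →ₐ[k] _) =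
        (rename ((![![1, 2, 3], ![0, 2, 3], ![0, 1, 3], ![0, 1, 2]] : Fin 4 → Fin 3 → Fin 5) a)).comp
          (MvPolynomial.aeval ((![![1, X 0, X 1, X 2], ![X 0, 1, X 1, X 2], ![X 0, X 1, 1, X 2], ![X 0, X 1, X 2, 1]] :
            Fin 4 → Fin 4 → MvPolynomial (Fin 3) k) a)) := by
      refine MvPolynomial.algHom_ext fun j => ?_
      rw [aeval_X, AlgHom.comp_apply, aeval_X]
      fin_cases a <;> fin_cases j <;> simp
    rw [hhom]
    rfl
  have h4 : (4 : Fin 5) ≠ Fin.castSucc a := fun h => (Fin.castSucc_lt_last a).ne h.symm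
  rw [hf, map_add, map_pow, aeval_X, if_neg h4, hcomp, hscale, hsub]
  obtain ⟨e, rfl⟩ : ∃ e, d = e + 2 := ⟨d - 2, by omega⟩
  rw [Nat.add_sub_cancel]
  ring

/-! ## §2 Non-divisibility, constant terms, the vertex -/

/-- `f = X₄² + F ∉ (Xᵢ)` for every `i` (`F ≠ 0` homogeneous of degree `d ≠ 0`). [elementary] -/
theorem f_not_mem_span_X_deg (d : ℕ) (hd : d ≠ 0) (F : MvPolynomial (Fin 4) k) (hF : F.IsHomogeneous d) (hF0 : F ≠ 0) (f : MvPolynomial (Fin 5) k)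
    (hf : f = X 4 ^ 2 + rename (Fin.castSucc : Fin 4 → Fin 5) F) (i : Fin 5) : f ∉ Ideal.span {(X i : MvPolynomial (Fin 5) k)} := by
  intro h
  obtain ⟨c, hc⟩ := Ideal.mem_span_singleton.mp h
  by_cases hi : i = 4
  · subst hi
    have := congrArg (MvPolynomial.aeval (fun j : Fin 5 => if j = (4 : Fin 5) then (0 : MvPolynomial (Fin 5) k) else X j)) hc
    rw [hf, map_add, map_pow, map_mul, aeval_X, if_pos rfl, aeval_rename] at this
    simp only [ne_eq, OfNat.ofNat_ne_zero, not_false_eq_true, zero_pow, zero_add, zero_mul] at this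
    have hid : MvPolynomial.aeval ((fun j : Fin 5 => if j = (4 : Fin 5) then (0 : MvPolynomial (Fin 5) k) else X j) ∘ Fin.castSucc) F =
        rename (Fin.castSucc : Fin 4 → Fin 5) F := by
      rw [show ((fun j : Fin 5 => if j = (4 : Fin 5) then (0 : MvPolynomial (Fin 5) k) else X j) ∘ Fin.castSucc) = X ∘ Fin.castSucc from
        funext fun j => by
          have hj4 : Fin.castSucc j ≠ (4 : Fin 5) := (Fin.castSucc_lt_last j).ne
          simp only [Function.comp_apply]; rw [if_neg hj4], ← aeval_rename, aeval_X_left_apply]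
    rw [hid] at this
    exact hF0 (rename_injective _ (Fin.castSucc_injective _) (by rw [this, map_zero]))
  · have := congrArg (MvPolynomial.eval (Pi.single 4 1 : Fin 5 → k)) hc
    rw [hf, map_add, map_pow, map_mul, eval_X, eval_X, Pi.single_eq_same, Pi.single_eq_of_ne hi, zero_mul, eval_rename] at this
    have h0 : MvPolynomial.eval ((Pi.single (4 : Fin 5) (1 : k)) ∘ Fin.castSucc) F = 0 := by
      have hfun : ((Pi.single (4 : Fin 5) (1 : k)) ∘ Fin.castSucc : Fin 4 → k) = 0 := by
        funext j
        simp only [Function.comp_apply, Pi.zero_apply]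
        exact Pi.single_eq_of_ne (Fin.castSucc_lt_last j).ne _
      rw [hfun, eval_zero]
      exact constantCoeff_eq_zero_of_isHomogeneous hF hd
    rw [h0] at this
    norm_num at this

/-- `f = X₄² + F` has no constant term (`F` homogeneous of degree `d ≠ 0`). [elementary] -/
theorem constantCoeff_f_deg (d : ℕ) (hd : d ≠ 0) (F : MvPolynomial (Fin 4) k) (hF : F.IsHomogeneous d) (f : MvPolynomial (Fin 5) k)
    (hf : f = X 4 ^ 2 + rename (Fin.castSucc : Fin 4 → Fin 5) F) : constantCoeff f = 0 := by
  rw [hf, map_add, map_pow, constantCoeff_X, constantCoeff_rename, constantCoeff_eq_zero_of_isHomogeneous hF hd]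
  norm_num

/-- `1 + X₄^m·q ∉ (X₄)` for `m ≥ 1` (evaluate at `0`). [elementary] -/
theorem one_add_X_pow_mul_not_mem_span_X (m : ℕ) (hm : m ≠ 0) (q G : MvPolynomial (Fin 5) k) (hG : G = 1 + X 4 ^ m * q) :
    G ∉ Ideal.span {(X 4 : MvPolynomial (Fin 5) k)} := by
  intro h
  obtain ⟨c, hc⟩ := Ideal.mem_span_singleton.mp h
  have := congrArg (MvPolynomial.eval (0 : Fin 5 → k)) hc
  rw [hG] at this
  simp [zero_pow hm] at this

/-- `X₄² + X_a^m·W ∉ (X_a)` for `a ≠ 4`, `m ≥ 1` (evaluate at `e₄`). [elementary] -/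
theorem X_sq_add_X_pow_mul_not_mem_span_X (a : Fin 5) (ha : a ≠ 4) (m : ℕ) (hm : m ≠ 0) (W G : MvPolynomial (Fin 5) k) (hG : G = X 4 ^ 2 + X a ^ m * W) :
    G ∉ Ideal.span {(X a : MvPolynomial (Fin 5) k)} := by
  intro h
  obtain ⟨c, hc⟩ := Ideal.mem_span_singleton.mp h
  have := congrArg (MvPolynomial.eval (Pi.single 4 1 : Fin 5 → k)) hc
  rw [hG] at this
  simp [ha, zero_pow hm] at this

/-- All partials of `f` vanish at the origin (`F` homogeneous of degree `d ≥ 2`). [elementary] -/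
theorem eval_zero_pderiv_f_deg (d : ℕ) (hd : 2 ≤ d) (F : MvPolynomial (Fin 4) k) (hF : F.IsHomogeneous d) (f : MvPolynomial (Fin 5) k)
    (hf : f = X 4 ^ 2 + rename (Fin.castSucc : Fin 4 → Fin 5) F) (i : Fin 5) : MvPolynomial.eval (0 : Fin 5 → k) (pderiv i f) = 0 := by
  have hq : (rename (Fin.castSucc : Fin 4 → Fin 5) F).IsHomogeneous d := hF.rename_isHomogeneous
  have hqi : (pderiv i (rename (Fin.castSucc : Fin 4 → Fin 5) F)).IsHomogeneous (d - 1) := hq.pderiv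
  rw [hf, map_add, map_add, Derivation.leibniz_pow, MvPolynomial.eval_zero]
  rw [constantCoeff_eq_zero_of_isHomogeneous hqi (by omega), add_zero]
  simp

/-- **The vertex of `x² + F_d` (`d ≥ 2`, `f` prime) is CLOSED, NOT REGULAR, and `dim 𝒪_{Y,v} = 4`.** [cite: Hartshorne1977, I Thm. 5.1; Matsumura1987, Thm. 13.5] -/
theorem vertex_closed_singular_deg (d : ℕ) (hd : 2 ≤ d) (F : MvPolynomial (Fin 4) k) (hF : F.IsHomogeneous d) (f : MvPolynomial (Fin 5) k)
    (hf : f = X 4 ^ 2 + rename (Fin.castSucc : Fin 4 → Fin 5) F) (hprime : Prime f)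
    (v : Spec (.of (MvPolynomial (Fin 5) k ⧸ Ideal.span {f})))
    (hv : v.asIdeal = Ideal.span (Set.range fun j : Fin 5 => Ideal.Quotient.mk (Ideal.span {f}) (X j))) :
    IsClosed ({v} : Set (Spec (.of (MvPolynomial (Fin 5) k ⧸ Ideal.span {f})))) ∧
      v ∉ Scheme.regularLocus (Spec (.of (MvPolynomial (Fin 5) k ⧸ Ideal.span {f}))) ∧
      ringKrullDim ((Spec (.of (MvPolynomial (Fin 5) k ⧸ Ideal.span {f}))).presheaf.stalk v) = (4 : ℕ) := by
  classical
  have hf0 := constantCoeff_f_deg k d (by omega) F hF f hf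
  refine ⟨DoublePointFermatCubicGerm.isClosed_origin k f hf0 v hv, ?_, ?_⟩
  · refine not_mem_regularLocus_Spec_of_not_isRegularLocalRing v ?_
    refine not_isRegularLocalRing_localization_of_pderiv_eval_eq_zero (0 : Fin 5 → k) hprime.ne_zero ?_ (eval_zero_pderiv_f_deg k d hd F hF f hf) v.asIdeal ?_
    · rw [MvPolynomial.eval_zero]; exact hf0
    · rw [hv, DoublePointFermatCubicGerm.comap_origin k f hf0, MvPolynomial.eval_zero, Fedder.span_range_X_eq_ker]
  · haveI : v.asIdeal.IsMaximal := by rw [hv]; exact DoublePointFermatCubicGerm.isMaximal_origin k f hf0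
    rw [ringKrullDim_stalk_Spec_eq]
    exact HypersurfaceLocalDim.stub_hypersurfaceLocalDim k 4 f hprime.ne_zero v.asIdeal

end Summit.ResolutionOfSingularities.ResolutionOfSingularities.Theorems.FInjectiveMacaulayfication.X2FormPointFloor

end
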